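import Summits.QuantumFields.YangMills.Theorems.LangevinControlUVOSLegsFromFemtoAndGapStubCollar6
import Literature.MathematicalPhysics.QuantumLattice.LatticeGaugeDLRSymmetry
import HarnessLib

/-!
# Crux `NT` (stmt-QuantumFields-19353), engine stub `stub_fcp6`: one plaquette orientation suffices for `FBL6`

Helper file (`--supports stmt-QuantumFields-19353`) of the fleet lead prover of crux `NT` (unit `ym-spine-19353-p1`);
an unconditional layer on the ENGINE side of the registered stub `stub_fcp6 : Statement.stub_fcp6`, companion of
`BalabanLadderNTBoundaryLawLargeDepth` (large depth suffices).

The plane-resolved femto boundary law `FBL6 G r a` (`Theorems/LangevinControlUVOSLegsFromFemtoAndGapDefs.lean`) asks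
for `|kerE (plane q x) − p q β| ≤ C₁ / depth⁴` for all SIX orientations `q = (i, j)`, `i < j`.  The cube kernels of
the lattice Yang–Mills specification are covariant under the coordinate permutations of `ℤ⁴` (tree
`ymSpecification_map_relabel_edgePerm`, Georgii 2011 (5.8); the Wilson action is hypercubic-invariant), axis-parallel
cubes go to axis-parallel cubes of the same side (`cubeEdges_map_edgePerm`) with the same depth function
(`depth_sitePerm`), and the single-plane field of orientation `(σ 0, σ 1)` at `σ·y` of the relabelled configuration
is the `(0, 1)`-field at `y` (`plane_perm`).  Hence (`fbl6_of_plane01`) a boundary law for the ONE orientation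
`(0, 1)` — all cubes, all exteriors, one reference value `p β` — gives the registered `FBL6` with `p q β := p β`
for every `q` and the same constant.

* geometry: `sitePerm_mem_cubeSites`, `cubeEdges_map_edgePerm`, `depth_sitePerm`;
* observable / kernel: `plane_eq_plaquetteObs`, `plane_perm`, `kerE_perm`, `kerE_plane_perm`;
* `fbl6_of_plane01` (the coordinate permutation with `σ 0 = i`, `σ 1 = j` is built from two swaps inline).
-/

set_option autoImplicit false

noncomputable section

open MeasureTheory Filter Topology
open Literature.MathematicalPhysics.QuantumFieldTheory Literature.MathematicalPhysics.QuantumLattice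
open Literature.Probability.LatticeModels
open Summit.QuantumFields.YangMills.Cruxes.OSLegsFromFemtoAndGap.DlrCollarTransfer

namespace Summit.QuantumFields.YangMills.Cruxes.NT.BoundaryLaw

/-! ## §1 Cube geometry under coordinate permutations -/

/-- A coordinate permutation maps the cube based at `c` onto the cube based at `σ·c` (same side). [folklore] -/
theorem sitePerm_mem_cubeSites (σ : Equiv.Perm (Fin 4)) (c y : Fin 4 → ℤ) (b : ℕ) :
    sitePerm σ y ∈ cubeSites (sitePerm σ c) b ↔ y ∈ cubeSites c b := by
  simp only [cubeSites, Fintype.mem_piFinset, sitePerm_apply, Finset.mem_Ico]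
  constructor
  · intro h j
    simpa using h (σ j)
  · intro h k
    exact h (σ.symm k)

/-- The interior edges of the cube based at `c` are relabelled onto the interior edges of the cube based at `σ·c`.
[folklore] -/
theorem cubeEdges_map_edgePerm (σ : Equiv.Perm (Fin 4)) (c : Fin 4 → ℤ) (b : ℕ) :
    (cubeEdges c b).map (edgePerm σ).toEmbedding = cubeEdges (sitePerm σ c) b := by
  ext e
  rw [Finset.mem_map_equiv]
  obtain ⟨y, k⟩ := e
  have hy : y = sitePerm σ (sitePerm σ.symm y) := by
    rw [← sitePerm_symm]; exact ((sitePerm σ).apply_symm_apply y).symm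
  have hyk : y + Pi.single k 1 = sitePerm σ (sitePerm σ.symm y + Pi.single (σ.symm k) 1) := by
    rw [sitePerm_add, sitePerm_single, Equiv.apply_symm_apply, ← hy]
  simp only [cubeEdges, Finset.mem_filter, Finset.mem_product, Finset.mem_univ, and_true,
    edgePerm_symm_apply]
  conv_rhs => rw [hyk, hy, sitePerm_mem_cubeSites, sitePerm_mem_cubeSites, ← hy]

/-- The depth function of a cube is invariant under coordinate permutations. [folklore] -/
theorem depth_sitePerm (σ : Equiv.Perm (Fin 4)) (c : Fin 4 → ℤ) (b : ℕ) (y : Fin 4 → ℤ) :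
    depth (sitePerm σ c) b (sitePerm σ y) = depth c b y := by
  unfold depth
  simp only [sitePerm_apply]
  refine le_antisymm ?_ ?_
  · refine Finset.le_inf' _ _ fun j _ => ?_
    have h := Finset.inf'_le (fun k : Fin 4 =>
        min (y (σ.symm k) - c (σ.symm k) + 1).toNat (c (σ.symm k) + ↑b - y (σ.symm k)).toNat)
      (Finset.mem_univ (σ j))
    simpa using h
  · refine Finset.le_inf' _ _ fun k _ => ?_
    exact Finset.inf'_le (fun j : Fin 4 => min (y j - c j + 1).toNat (c j + ↑b - y j).toNat)
      (Finset.mem_univ (σ.symm k))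

/-! ## §2 The single-plane field and the cube kernel under coordinate permutations -/

section Kernel

variable (G : Type) [Group G] [TopologicalSpace G] [IsTopologicalGroup G] [CompactSpace G]
  [MeasurableSpace G] [BorelSpace G] (r : LatticeRep G)

omit [IsTopologicalGroup G] [CompactSpace G] [BorelSpace G] in
/-- The single-plane field of orientation `q` at `x` is the plaquette observable of the plaquette at `x` in the
plane `q` (the translate to the origin undone). [folklore] -/
theorem plane_eq_plaquetteObs (q : Fin 4 × Fin 4) (x : Fin 4 → ℤ) (U : LGConfig 4 G) :
    plane G r q x U = plaquetteObs r.ρ x q.1 q.2 U := by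
  unfold plane plaquetteObs
  have h := plaquetteHolonomyZd_configShift_add (-x) U x q.1 q.2
  rw [add_neg_cancel] at h
  rw [h]

omit [IsTopologicalGroup G] [CompactSpace G] [BorelSpace G] in
/-- **Coordinate permutations act on the single-plane fields**: the `(σ i, σ j)`-field at `σ·y` of the relabelled
configuration is the `(i, j)`-field at `y`. [folklore] -/
theorem plane_perm (σ : Equiv.Perm (Fin 4)) (q : Fin 4 × Fin 4) (y : Fin 4 → ℤ) (U : LGConfig 4 G) :
    plane G r (σ q.1, σ q.2) (sitePerm σ y) (relabelConfig (edgePerm σ) U) = plane G r q y U := by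
  rw [plane_eq_plaquetteObs, plane_eq_plaquetteObs]
  unfold plaquetteObs
  rw [plaquetteHolonomyZd_relabel_edgePerm]

/-- **Covariance of the cube kernels under coordinate permutations**: the kernel of the cube `σ·(c, b)` with the
relabelled exterior, tested on `F`, is the kernel of `(c, b)` with exterior `η` tested on `F ∘ σ` (tree
`ymSpecification_map_relabel_edgePerm` + change of variables along the measurable automorphism). [folklore] -/
theorem kerE_perm (σ : Equiv.Perm (Fin 4)) (β : ℝ) (c : Fin 4 → ℤ) (b : ℕ) (η : LGConfig 4 G)
    (F : LGConfig 4 G → ℝ) :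
    kerE G r β (sitePerm σ c) b (relabelConfig (edgePerm σ) η) F =
      kerE G r β c b η (F ∘ relabelConfig (edgePerm σ)) := by
  haveI : SecondCountableTopology G :=
    (r.continuous.isClosedEmbedding r.injective).isEmbedding.secondCountableTopology
  unfold kerE
  rw [← cubeEdges_map_edgePerm, ← ymSpecification_map_relabel_edgePerm r.ρ r.continuous β σ (cubeEdges c b) η,
    integral_map_equiv]
  rfl

/-- **The kernel mean of the `(σ 0, σ 1)`-field at `σ·y` in the cube `σ·(c, b)` with exterior `σ·η` equals the kernel
mean of the `(0, 1)`-field at `y` in `(c, b)` with exterior `η`.** [folklore] -/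
theorem kerE_plane_perm (σ : Equiv.Perm (Fin 4)) (β : ℝ) (c : Fin 4 → ℤ) (b : ℕ) (η : LGConfig 4 G)
    (q : Fin 4 × Fin 4) (y : Fin 4 → ℤ) :
    kerE G r β (sitePerm σ c) b (relabelConfig (edgePerm σ) η) (plane G r (σ q.1, σ q.2) (sitePerm σ y)) =
      kerE G r β c b η (plane G r q y) := by
  rw [kerE_perm]
  congr 1
  funext U
  exact plane_perm G r σ q y U

end Kernel

/-! ## §3 One orientation suffices -/

section Main

variable (G : Type) [Group G] [TopologicalSpace G] [IsTopologicalGroup G] [CompactSpace G]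
  [MeasurableSpace G] [BorelSpace G] (r : LatticeRep G)

/-- **`FBL6` from the `(0, 1)`-orientation alone.**  If on every femto cube (`b · a β ≤ ℓ₁`, `β ≥ β₁`), for every
exterior and every site of depth `≥ 2`, the kernel mean of the `(0,1)`-plaquette field is within `C₁ / depth⁴` of a
reference value `p β`, then the registered plane-resolved boundary law `FBL6 G r a` holds, with reference values
`p q β := p β` for all six orientations and the same constant: transport along a coordinate permutation with
`σ 0 = i`, `σ 1 = j` (`kerE_plane_perm`, `depth_sitePerm`). [folklore] -/
theorem fbl6_of_plane01 (a : ℝ → ℝ)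
    (h : ∃ (C₁ β₁ ℓ₁ : ℝ) (p : ℝ → ℝ), 0 < ℓ₁ ∧ 0 ≤ C₁ ∧ ∀ β : ℝ, β₁ ≤ β →
      ∀ (c : Fin 4 → ℤ) (b : ℕ), (b : ℝ) * a β ≤ ℓ₁ → ∀ (η : LGConfig 4 G) (x : Fin 4 → ℤ),
        2 ≤ depth c b x → |kerE G r β c b η (plane G r (0, 1) x) - p β| ≤ C₁ / (depth c b x : ℝ) ^ 4) :
    FBL6 G r a := by
  obtain ⟨C₁, β₁, ℓ₁, p, hℓ₁, hC₁, H⟩ := h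
  refine ⟨C₁, β₁, ℓ₁, fun _ β => p β, hℓ₁, hC₁, ?_⟩
  intro β hβ c b hb η q x hq hx
  -- a coordinate permutation with `σ 0 = q.1`, `σ 1 = q.2` (two swaps; the tree's
  -- `Literature.NumberTheory.EllipticCurves.BinaryQuartic.exists_perm_fin_four_zero_one` is the same fact by `decide`)
  obtain ⟨σ, h0, h1⟩ : ∃ σ : Equiv.Perm (Fin 4), σ 0 = q.1 ∧ σ 1 = q.2 := by
    have hne : q.1 ≠ q.2 := ne_of_lt hq
    have hk : Equiv.swap (0 : Fin 4) q.1 1 ≠ q.1 := by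
      intro hk
      have h01 : (Equiv.swap (0 : Fin 4) q.1) 1 = Equiv.swap (0 : Fin 4) q.1 0 := by
        rw [hk, Equiv.swap_apply_left]
      exact absurd ((Equiv.swap (0 : Fin 4) q.1).injective h01) one_ne_zero
    refine ⟨(Equiv.swap 0 q.1).trans (Equiv.swap (Equiv.swap 0 q.1 1) q.2), ?_, ?_⟩
    · rw [Equiv.trans_apply, Equiv.swap_apply_left, Equiv.swap_apply_of_ne_of_ne hk.symm hne]
    · rw [Equiv.trans_apply, Equiv.swap_apply_left]
  -- pull the data back along `σ`
  set c₀ : Fin 4 → ℤ := sitePerm σ.symm c with hc₀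
  set x₀ : Fin 4 → ℤ := sitePerm σ.symm x with hx₀
  set η₀ : LGConfig 4 G := (relabelConfig (edgePerm σ)).symm η with hη₀
  have hc : sitePerm σ c₀ = c := by
    rw [hc₀, ← sitePerm_symm]; exact (sitePerm σ).apply_symm_apply c
  have hxx : sitePerm σ x₀ = x := by
    rw [hx₀, ← sitePerm_symm]; exact (sitePerm σ).apply_symm_apply x
  have hη : relabelConfig (edgePerm σ) η₀ = η := (relabelConfig (edgePerm σ)).apply_symm_apply η
  have hq' : q = (σ (0, (1 : Fin 4)).1, σ (0, (1 : Fin 4)).2) := by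
    rw [h0, h1]
  have hker : kerE G r β c b η (plane G r q x) = kerE G r β c₀ b η₀ (plane G r (0, 1) x₀) := by
    rw [← hc, ← hxx, ← hη, hq']
    exact kerE_plane_perm G r σ β c₀ b η₀ (0, 1) x₀
  have hdepth : depth c b x = depth c₀ b x₀ := by
    rw [← hc, ← hxx, depth_sitePerm]
  rw [hker, hdepth]
  exact H β hβ c₀ b hb η₀ x₀ (hdepth ▸ hx)

end Main

end Summit.QuantumFields.YangMills.Cruxes.NT.BoundaryLaw

end
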